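import Literature.NumberTheory.Automorphic.UnitaryGroupTruncatedTracePolynomialOfRows
import Literature.NumberTheory.Automorphic.UnitaryGroupTruncatedKernelIntegrableOfSiegel
import HarnessLib

/-!
# `UnitaryGroup.TruncatedTracePolynomial` from `TruncatedKernelIntegrable` alone (the torus Siegel set of row
# H9a discharged), and at a CM extension `L/L⁺`
(Arthur, *The trace formula in invariant form*, Ann. of Math. 114 (1981), Prop. 2.3; Rogawski, *Automorphic
Representations of Unitary Groups in Three Variables* (1990), §2.1 p. 12; Shokranian (1992), Thm. (5.7))

Topic `NumberTheory/Automorphic`; namespace `Literature.NumberTheory.Automorphic.UnitaryGroup`. THEOREMS ONLY over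
accepted tree modules: no definition, no named fact, no instance, no notation, no `sorry`. The CLOSER of the T1-qs
LAW 2 road (cell `pub/hodgecm-mathlib`, crux H413): ★ (L2-e2) `truncatedTracePolynomial_of_integrable_of_torusSiegel`
takes the torus Siegel set in coordinates; ★ H9a `exists_torusSiegelSet` (`[E:F] = 2`, `c ≠ 1`) supplies it —
`S := T(𝔸_F) ∩ S_T` (closed), `C₀ = C₁ = W`, EXPORT and COVER clauses read on `torusInBorel` — so that

* §1 `exists_torusSiegel_coordinates` — the coordinate torus Siegel datum from ★ H9a;
* §2 **`truncatedTracePolynomial_of_truncatedKernelIntegrable`** — for `c² = 1 ≠ c`, `[E:F] = 2`, unimodularity,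
  the Iwasawa decomposition and the law `TruncatedKernelIntegrable F E c`: `TruncatedTracePolynomial F E c`;
* §3 **`truncatedTracePolynomial_cm_of_truncatedKernelIntegrable`** — at a CM extension `L/L⁺` with
  `c = complexConj`, everything but `TruncatedKernelIntegrable L⁺ L c` is ★ (★ `complexConj_mul_complexConj`,
  `IsCMField.complexConj_ne_one`, `Algebra.IsQuadraticExtension.finrank_eq_two`, ★
  `forall_isHaarMeasure_isMulRightInvariant_quasiSplit_cm_three`, ★
  `exists_mem_borelAdelic_mul_mem_standardMaximalCompactGL_cm_three`): LAW 2 ⇐ LAW 1 at the line's `G = U(Φ₃)`.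

## References

* J. Arthur, *The trace formula in invariant form*, Ann. of Math. 114 (1981), Prop. 2.3
  [Arthur1981TraceFormulaInvariantForm].
* J. D. Rogawski, *Automorphic Representations of Unitary Groups in Three Variables*, Annals of Mathematics
  Studies 123 (1990), §2.1 (p. 12) [Rogawski1990].
* S. Shokranian, *The Selberg–Arthur Trace Formula*, LNM 1503 (1992), Thm. (5.7), Rem. (5.8) [Shokranian1992].
-/

set_option autoImplicit false

noncomputable section

open MeasureTheory Measure NumberField IsDedekindDomain Set Literature.MeasureTheory.Group
open scoped NNReal ENNReal Pointwise

namespace Literature.NumberTheory.Automorphic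

namespace UnitaryGroup

variable {F E : Type} [Field F] [NumberField F] [Field E] [NumberField E] [Algebra F E]
  {c : E ≃ₐ[F] E}

/-! ## §1 The coordinate torus Siegel datum from row H9a -/

/-- **The coordinate torus Siegel datum** consumed by ★ `truncatedTracePolynomial_of_integrable_of_torusSiegel`, from
★ H9a `exists_torusSiegelSet`: `S := T(𝔸_F) ∩ S_T` is closed, its elements have `d₀ = w · z_E(e^s)` with `w ∈ W`,
`d₁ ∈ W` (EXPORT), and every orbit of the rational torus `(rationalBorel F E c 3).subgroupOf (torusInBorel F E c 3)`
meets it (COVER: the rational `τ` with `torusPart τ = τ` lies in `T(𝔸_F)`). [cite: Rogawski1990, §2.2 (p. 13)]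
[cite: Borel1969, §13.1] -/
theorem exists_torusSiegel_coordinates (h2 : Module.finrank F E = 2) (hc1 : c ≠ 1) :
    ∃ (C₀ C₁ : Set (AdeleRing (𝓞 E) E)ˣ) (S : Set (torusInBorel F E c 3)),
      IsCompact C₀ ∧ IsCompact C₁ ∧ IsClosed S ∧
      (∀ t ∈ S, (∃ w ∈ C₀, ∃ s : ℝ, diagUnit (t : borelAdelic F E c 3).2 0 = w * posRealIdele E (expUnitNNReal s)) ∧
        diagUnit (t : borelAdelic F E c 3).2 1 ∈ C₁) ∧
      (∀ t : torusInBorel F E c 3,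
        ∃ τ : (rationalBorel F E c 3).subgroupOf (torusInBorel F E c 3), τ • t ∈ S) := by
  obtain ⟨ST, W, hSTc, hWc, -, hexp, hSTcov, -, -⟩ := exists_torusSiegelSet F E c h2 hc1
  refine ⟨W, W, ((↑) : torusInBorel F E c 3 → borelAdelic F E c 3) ⁻¹' ST, hWc, hWc,
    hSTc.preimage continuous_subtype_val, fun t ht => ?_, fun t => ?_⟩
  · obtain ⟨w, hw, s, h0, h1, -, -⟩ := hexp (t : borelAdelic F E c 3) ht
    exact ⟨⟨w, hw, s, h0⟩, h1⟩
  · obtain ⟨τ, hτrat, hτt, hτS⟩ := hSTcov (t : borelAdelic F E c 3) ((mem_torusInBorel_iff_torusPart_eq _).1 t.2)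
    exact ⟨⟨⟨τ, (mem_torusInBorel_iff_torusPart_eq τ).2 hτt⟩, Subgroup.mem_subgroupOf.2 (Subgroup.mem_comap.2 hτrat)⟩,
      hτS⟩

/-! ## §2 LAW 2 from LAW 1 -/

/-- **`TruncatedTracePolynomial F E c` FROM `TruncatedKernelIntegrable F E c`** (for `c² = 1 ≠ c`, `[E:F] = 2`,
unimodularity of `U(J₃)(𝔸_F)` and the adelic Iwasawa decomposition): ★ (L2-e2)
`truncatedTracePolynomial_of_integrable_of_torusSiegel` fed by §1. [cite: Arthur1981TraceFormulaInvariantForm, Prop. 2.3]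
[cite: Rogawski1990, §2.1 (p. 12)] [cite: Shokranian1992, Thm. (5.7) and Rem. (5.8)] -/
theorem truncatedTracePolynomial_of_truncatedKernelIntegrable (hc : c * c = 1) (hc1 : c ≠ 1)
    (h2 : Module.finrank F E = 2)
    (hunimod : ∀ [MeasurableSpace (quasiSplit F E c 3).Adelic] [BorelSpace (quasiSplit F E c 3).Adelic]
      (νG : Measure (quasiSplit F E c 3).Adelic), νG.IsHaarMeasure → νG.IsMulRightInvariant)
    (hBK : ∀ g : (quasiSplit F E c 3).Adelic, ∃ b ∈ borelAdelic F E c 3, ∃ k : (quasiSplit F E c 3).Adelic,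
      adelicVal F E c 3 ((StdForm.antidiagonal 3).over E) k ∈ standardMaximalCompactGL 3 E ∧ g = b * k)
    (hint : TruncatedKernelIntegrable F E c) :
    TruncatedTracePolynomial F E c :=
  truncatedTracePolynomial_of_integrable_of_torusSiegel hc hc1 hunimod hBK hint (exists_torusSiegel_coordinates h2 hc1)

/-! ## §3 At a CM extension -/

/-- **LAW 2 ⇐ LAW 1 AT A CM EXTENSION `L/L⁺` (`c = ` complex conjugation):** `TruncatedKernelIntegrable L⁺ L c →
TruncatedTracePolynomial L⁺ L c` — `c² = 1`, `c ≠ 1`, `[L:L⁺] = 2`, unimodularity (★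
`forall_isHaarMeasure_isMulRightInvariant_quasiSplit_cm_three`) and the Iwasawa decomposition (★
`exists_mem_borelAdelic_mul_mem_standardMaximalCompactGL_cm_three`) discharged.
[cite: Arthur1981TraceFormulaInvariantForm, Prop. 2.3] [cite: Rogawski1990, §2.1 (p. 12)] -/
theorem truncatedTracePolynomial_cm_of_truncatedKernelIntegrable (L : Type) [Field L] [NumberField L] [IsCMField L]
    (hint : TruncatedKernelIntegrable (↥(maximalRealSubfield L)) L (IsCMField.complexConj L)) :
    TruncatedTracePolynomial (↥(maximalRealSubfield L)) L (IsCMField.complexConj L) :=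
  truncatedTracePolynomial_of_truncatedKernelIntegrable (complexConj_mul_complexConj L) (IsCMField.complexConj_ne_one L)
    (Algebra.IsQuadraticExtension.finrank_eq_two (↥(maximalRealSubfield L)) L)
    (forall_isHaarMeasure_isMulRightInvariant_quasiSplit_cm_three L)
    (exists_mem_borelAdelic_mul_mem_standardMaximalCompactGL_cm_three L) hint

end UnitaryGroup

end Literature.NumberTheory.Automorphic
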